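import Summits.BirchSwinnertonDyer.Rank1Residual.F1Sign2.NormDepthCombinatoricsAtTwo
import HarnessLib

/-!
# The top flag level and REF2's PREDICTION #14 — a kernel certificate on the norm-depth model (cell `bsd-f1-sign2`, typer -ty g18)

PURE `ℕ`-COMBINATORICS, `decide +kernel` only; no curve, no field, no conjecture, no named fact.  Companion to
`NormDepthCombinatoricsAtTwo.lean` (p725951; REF2 slot read PASS, v54 §15), in the vocabulary `flagJumpSet e` = `J(e)` (the `[2]`-filtration flag
jumps) and `normHitSet e f` = `H(f)` (the `K`-levels hit by leading terms of formal norms from the ramified quadratic extension of different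
exponent `f`).  REF2-PLACEMENT v54 §14 **PREDICTION #14** (pre-registered 14:35Z BEFORE -imc's add7 layer-4 Gram verdict; INBOX 2026-08-29T14:36:08Z and the
kernel suggestion of 14:48:42Z): granting -imc's criterion «`Q_δ` alternating ⟺ `c ∈ W_δ` ⟺ `max J ∈ H(f)`» (PREDICTIONS #10 + #13 + O-59γ), the model has EXACTLY ONE
non-alternating conductor per cyclotomic layer `n` (`e = 2ⁿ`, `2 ≤ f ≤ 2e + 1`): **`f*(n) = 2e + [n even]`** — layer 1: 4; layer 2: 9; layer 3: 16 (✓ -imc add6 (c) 7/7);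
layer 4: 33 (all unit levels incl. `f = 32` alternating — superseding the withdrawn #11); layer 5: 64; layer 6: 129 (layer 7: 256, not certified here for kernel cost).
WHY (REF2): `max J = e + ⌊e/3⌋` is odd iff `n` is even; an odd top level is reachable only as a trace level `⌊(m′+f)/2⌋` with `2m′` above it, which fails exactly at
`f = 2e + 1`; an even top level fails exactly at `f = 2e`.  This file certifies the MODEL side of #14 by the kernel (`flagJumpSet_sup_layers`, `topLevelMissed_iff_layer1..6`);
the ENGINE side (is `Q_δ` non-alternating exactly at `f*`?) is -imc's add7/ENGINE test — should add7 show `f = 32` non-alternating at layer 4, the criterion, not this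
arithmetic, fails (REF2: «the informative outcome»).  REF2 v54 §15.1 (answer to p725951's open flag): the `H`-model COVERS the odd classes `f = 2e + 1` (`d = f` for every
ramified quadratic `L/K`, so Serre V §3 Lemme 4 applies verbatim; tie levels at odd `f` are supplied from `L`-level `r + 1` in the trace regime), so
`normIndex e (2e+1)` = Jacobsthal (`NormDepthCombinatoricsAtTwo.normIndex_odd_classes`: 1, 1, 3, 5, 11, 21, 43) is corollary-of-print on the same footing as the even classes.
Nothing here bears on BSD; 23715 not closed.
-/

namespace Summit.BirchSwinnertonDyer.Rank1Residual.F1Sign2.NormDepthAtTwo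

/-- The TOP flag level `max J(e) = e + ⌊e/3⌋` at `e = 2, 4, 8, 16, 32, 64` (layers 1–6): `2, 5, 10, 21, 42, 85` — odd exactly at the even layers (REF2 v54 §14). -/
theorem flagJumpSet_sup_layers :
    (flagJumpSet 2).sup id = 2 ∧ (flagJumpSet 4).sup id = 5 ∧ (flagJumpSet 8).sup id = 10 ∧ (flagJumpSet 16).sup id = 21 ∧
      (flagJumpSet 32).sup id = 42 ∧ (flagJumpSet 64).sup id = 85 := by
  decide +kernel

/-- PREDICTION #14, layer 1 (`e = 2`): among `2 ≤ f ≤ 5` the top level `2` is missed by `H(f)` exactly at `f* = 4 = 2e`. -/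
theorem topLevelMissed_iff_layer1 : ∀ f ∈ Finset.Icc 2 5, ((flagJumpSet 2).sup id ∉ normHitSet 2 f ↔ f = 4) := by
  decide +kernel

/-- PREDICTION #14, layer 2 (`e = 4`): among `2 ≤ f ≤ 9` the top level `5` is missed exactly at `f* = 9 = 2e + 1` (retro-diction testable now, REF2 v54 §14). -/
theorem topLevelMissed_iff_layer2 : ∀ f ∈ Finset.Icc 2 9, ((flagJumpSet 4).sup id ∉ normHitSet 4 f ↔ f = 9) := by
  decide +kernel

/-- PREDICTION #14, layer 3 (`e = 8`): among `2 ≤ f ≤ 17` the top level `10` is missed exactly at `f* = 16 = 2e` (✓ -imc §10.99-add6 (c): 7/7). -/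
theorem topLevelMissed_iff_layer3 : ∀ f ∈ Finset.Icc 2 17, ((flagJumpSet 8).sup id ∉ normHitSet 8 f ↔ f = 16) := by
  decide +kernel

/-- PREDICTION #14, layer 4 (`e = 16`): among `2 ≤ f ≤ 33` the top level `21` is missed exactly at `f* = 33 = 2e + 1` — every UNIT level, `f = 32` included, hits it
(the co-signed form of -imc's pre-registration; #11 «f = 32» withdrawn). -/
theorem topLevelMissed_iff_layer4 : ∀ f ∈ Finset.Icc 2 33, ((flagJumpSet 16).sup id ∉ normHitSet 16 f ↔ f = 33) := by
  decide +kernel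

/-- PREDICTION #14, layer 5 (`e = 32`): among `2 ≤ f ≤ 65` the top level `42` is missed exactly at `f* = 64 = 2e` (the level-1 units; `f = 65` alternating). -/
theorem topLevelMissed_iff_layer5 : ∀ f ∈ Finset.Icc 2 65, ((flagJumpSet 32).sup id ∉ normHitSet 32 f ↔ f = 64) := by
  decide +kernel

/-- PREDICTION #14, layer 6 (`e = 64`): among `2 ≤ f ≤ 129` the top level `85` is missed exactly at `f* = 129 = 2e + 1`. -/
theorem topLevelMissed_iff_layer6 : ∀ f ∈ Finset.Icc 2 129, ((flagJumpSet 64).sup id ∉ normHitSet 64 f ↔ f = 129) := by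
  decide +kernel

end Summit.BirchSwinnertonDyer.Rank1Residual.F1Sign2.NormDepthAtTwo
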